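import Literature.Topology.FourManifolds.ConcordanceOffPole
import Literature.Topology.FourManifolds.ConcordanceEndSpliceTop
import Literature.Topology.FourManifolds.KnotEndAdjust
import Literature.Topology.FourManifolds.KnotUnitSpeedArc
import Literature.Topology.FourManifolds.LongAnnulusChart
import Literature.Topology.FourManifolds.LongAnnulusAxis
import Literature.Topology.FourManifolds.ConcordanceStraighteningBoth
import Literature.Topology.FourManifolds.KnotsIsotopyProofs
import HarnessLib

/-!
# From a concordance to a long annulus with a common flat arc at both ends

Topic `Literature/Topology/FourManifolds`; assembly of the preparatory steps of the proof
programme of the Fox–Milnor fact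
`Literature.Topology.FourManifolds.Knot.exists_isConnectedSum_isConcordant`. Everything here is
proved; no named fact is introduced.

**Main result** (`Knot.IsConcordant.exists_flat_longAnnulus`): if `K` and `K'` are concordant,
there are isotopic knots `K₁ ~ K`, `K₂ ~ K'` off the south pole and a long annulus
`A : LongAnnulus η` of `ℝ³ × ℝ` (`LongAnnulusShear.lean`) whose end curves are the chart images of
`K₁`, `K₂` and which has **flat collars at a common parameter** (`A.FlatAt θ₁ ζ x₀ e σ`,
`LongAnnulusAxis.lean`, with the affine `σ θ = 2πθ - θa`). Chain: a conical representative
(`IsConcordance.exists_conical`), rotated off the south pole (`exists_offPole`); then the lower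
cone is spliced (`exists_splice_bottom`) successively with the flattening isotopy of
`KnotFlatArc.lean` (`exists_flatArc_isotopy`), the homothety normalising the speed at the
midpoint (`exists_ambientIsotopy_chartAffine`) and the unit-speed shear
(`exists_ambientIsotopy_unitSpeed`); the upper cone likewise (`exists_splice_top`), followed by the
rigid motion taking its segment onto the lower one (translation and `horizRot`) and the rotation
of the parameter aligning the midpoints (`exists_ambientIsotopy_rotateParam`); all orbits stay off
the south pole, so the final conical concordance is read in the chart
(`IsConicalConcordance.exists_longAnnulus`).

## References

* R. H. Fox, J. W. Milnor, *Singularities of 2-spheres in 4-space and cobordism of knots*, Osaka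
  J. Math. 3 (1966), §1. [FoxMilnor1966]

## Design notes

No named facts, no `sorry`; `𝔼 n`, `𝕊 n` are local notation as in `Knots.lean`.
-/

open scoped Manifold Topology ContDiff Real RealInnerProductSpace
open Function Set Metric Filter

noncomputable section

namespace Literature.Topology.FourManifolds

/-- Local notation: `𝔼 n` is the model Euclidean space `EuclideanSpace ℝ (Fin n)`. -/
local notation "𝔼 " n:arg => EuclideanSpace ℝ (Fin n)

/-- Local notation: `𝕊 n` is the unit sphere in `EuclideanSpace ℝ (Fin (n + 1))`. -/
local notation "𝕊 " n:arg => (Metric.sphere (0 : EuclideanSpace ℝ (Fin (n + 1))) 1)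

attribute [local instance] fact_finrank_euclideanSpace_succ

namespace Knot

open KnotsInBall StripFrame AffineIsotopy

/-! ### The flattening isotopy of `KnotFlatArc.lean`, with the isotopy exposed -/

/-- **The flattening isotopy.** For a knot `K` off the south pole there is an ambient isotopy `G`
of `𝕊³`, whose orbit of `K` stays off the south pole, after which the chart image of the knot
traverses a straight segment: `ψ (G₁ (K (circlePoint θ))) = p + σ θ • e` for `θ ∈ [α, β]`,
`σ' > 0` on `[α, β]`, `σ θ₁ = 0`, `α < θ₁ < β`, `‖e‖ = 1`, `e` horizontal
(`ArcFrame.Scales.exists_ambientIsotopy_curve` transported along `ψ`, as in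
`ArcFrame.Scales.exists_knot` and `exists_flatArc_param`). [folklore] -/
theorem exists_flatArc_isotopy (K : Knot) (hK : ∀ x, K x ≠ southPole) :
    ∃ G : AmbientIsotopy (𝓡 3) (𝕊 3), (∀ t x, G.toFun t (K x) ≠ southPole) ∧
      ∃ (p e : 𝔼 3), ‖e‖ = 1 ∧ e 2 = 0 ∧
        ∃ (α θ₁ β : ℝ) (σ : ℝ → ℝ), α < θ₁ ∧ θ₁ < β ∧ ContDiff ℝ ∞ σ ∧
          (∀ θ ∈ Icc α β, 0 < deriv σ θ) ∧ σ θ₁ = 0 ∧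
          ∀ θ ∈ Icc α β, psi (G.toFun 1 (K (circlePoint θ))) = p + σ θ • e := by
  obtain ⟨A⟩ := nonempty_arcFrame hK
  obtain ⟨S⟩ := A.nonempty_scales
  obtain ⟨G₀, ⟨R, hR⟩, hG₀⟩ := S.exists_ambientIsotopy_curve
  set G := G₀.alongChart (φ := psi) contMDiffOn_psi contMDiff_psi_symm psi_target hR with hG
  have ha := S.a_pos
  have hcurve : ∀ θ, psi (G.toFun 1 (K (circlePoint θ))) = S.curve θ 1 := by
    intro θ
    rw [hG, AmbientIsotopy.alongChart_toFun, chartTransport_of_mem _ (mem_psi_source (hK _)),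
      psi_apply_psi_symm, ← chartCurve_apply, hG₀ θ 1 ⟨zero_le_one, le_rfl⟩]
  refine ⟨G, fun t x ↦ ?_, S.pHat, A.e, A.norm_e, A.e_two, ?_⟩
  · rw [hG, AmbientIsotopy.alongChart_toFun, chartTransport_of_mem _ (mem_psi_source (hK x))]
    exact psi_symm_ne_southPole _
  -- the parametrisation of the segment by `σ` over `[τ (-a/4), τ (a/4)]` (as in `exists_flatArc_param`)
  have har : S.a / 4 < A.r := by linarith [S.a_le, A.r_pos]
  have hm : ∀ s, |s| ≤ S.a / 4 → A.τ s ∈ Ioo (A.θ₀ - A.w) (A.θ₀ + A.w) ∧ A.σ (A.τ s) = s :=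
    fun s hs ↦ ⟨A.τ_mem s (by linarith), A.sCoord_τ s (by linarith)⟩
  have hmono : StrictMonoOn A.σ (Ioo (A.θ₀ - A.w) (A.θ₀ + A.w)) :=
    strictMonoOn_of_deriv_pos (convex_Ioo _ _)
      ((contDiff_sCoord hK A.θ₀).continuous.continuousOn) fun θ hθ ↦
        A.deriv_pos θ (by rwa [interior_Ioo] at hθ)
  obtain ⟨hαm, hασ⟩ := hm (-(S.a / 4)) (by rw [abs_neg, abs_of_pos (by linarith)])
  obtain ⟨hβm, hβσ⟩ := hm (S.a / 4) (by rw [abs_of_pos (by linarith)])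
  have hθ₀m : A.θ₀ ∈ Ioo (A.θ₀ - A.w) (A.θ₀ + A.w) := ⟨by linarith [A.w_pos], by linarith [A.w_pos]⟩
  have hσ0 : A.σ A.θ₀ = 0 := sCoord_self A.θ₀
  have hαθ : A.τ (-(S.a / 4)) < A.θ₀ := by
    by_contra hle; push Not at hle
    have := hmono.monotoneOn hθ₀m hαm hle
    rw [hασ, hσ0] at this; linarith
  have hθβ : A.θ₀ < A.τ (S.a / 4) := by
    by_contra hle; push Not at hle
    have := hmono.monotoneOn hβm hθ₀m hle
    rw [hβσ, hσ0] at this; linarith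
  have hsub : Icc (A.τ (-(S.a / 4))) (A.τ (S.a / 4)) ⊆ Ioo (A.θ₀ - A.w) (A.θ₀ + A.w) :=
    fun θ hθ ↦ ⟨lt_of_lt_of_le hαm.1 hθ.1, lt_of_le_of_lt hθ.2 hβm.2⟩
  refine ⟨A.τ (-(S.a / 4)), A.θ₀, A.τ (S.a / 4), A.σ, hαθ, hθβ, contDiff_sCoord hK A.θ₀,
    fun θ hθ ↦ A.deriv_pos θ (hsub hθ), hσ0, fun θ hθ ↦ ?_⟩
  have hθw := hsub hθ
  have hσle : |A.σ θ| ≤ S.a / 4 := by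
    rw [abs_le]
    constructor
    · rw [← hασ]; exact hmono.monotoneOn hαm hθw hθ.1
    · rw [← hβσ]; exact hmono.monotoneOn hθw hβm hθ.2
  rw [hcurve]
  exact S.curve_one_eq hθw hσle

/-! ### Conical representatives -/

/-- A concordance has a conical representative of some width. [folklore] -/
theorem IsConcordant.exists_isConicalConcordance {K K' : Knot} (h : K.IsConcordant K') :
    ∃ (f : (𝕊 1) × ℝ → 𝔼 4) (δ : ℝ), IsConicalConcordance K K' f δ := by
  obtain ⟨f₀, hf₀⟩ := h
  obtain ⟨f, hf, δ, hδ, hδ4, hc₁, hc₂⟩ := hf₀.exists_conical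
  exact ⟨f, δ, ⟨hf, hδ, hδ4, hc₁, hc₂⟩⟩

/-! ### Directions off the pole survive the splices -/

/-- The directions of a spliced lower cone stay off the pole. [folklore] -/
theorem dirOff_of_splice_bottom {K : Knot} {f f' : (𝕊 1) × ℝ → 𝔼 4} {ε : ℝ}
    {G : AmbientIsotopy (𝓡 3) (𝕊 3)}
    (hold : ∀ (x : 𝕊 1) (t : ℝ), t ∈ Icc (1 : ℝ) 2 → ‖f (x, t)‖⁻¹ • f (x, t) ≠ ((southPole : 𝕊 3) : 𝔼 4))
    (hG : ∀ t x, G.toFun t (K x) ≠ southPole)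
    (h1 : ∀ (x : 𝕊 1) (t : ℝ), 1 + ε < t → f' (x, t) = f (x, t))
    (h2 : ∀ (x : 𝕊 1) (t : ℝ), t ≤ 1 + ε → ∃ s : ℝ, f' (x, t) = t • ((G.toFun s (K x) : 𝕊 3) : 𝔼 4)) :
    ∀ (x : 𝕊 1) (t : ℝ), t ∈ Icc (1 : ℝ) 2 → ‖f' (x, t)‖⁻¹ • f' (x, t) ≠ ((southPole : 𝕊 3) : 𝔼 4) := by
  intro x t ht
  rcases le_or_gt t (1 + ε) with h | h
  · obtain ⟨s, hs⟩ := h2 x t h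
    have ht0 : 0 < t := by linarith [ht.1]
    rw [hs, norm_smul, norm_eq_of_mem_sphere, mul_one, Real.norm_eq_abs, abs_of_pos ht0, smul_smul,
      inv_mul_cancel₀ ht0.ne', one_smul]
    exact fun heq ↦ hG s x (Subtype.ext heq)
  · rw [h1 x t h]; exact hold x t ht

/-- The directions of a spliced upper cone stay off the pole. [folklore] -/
theorem dirOff_of_splice_top {K : Knot} {f f' : (𝕊 1) × ℝ → 𝔼 4} {ε : ℝ}
    {G : AmbientIsotopy (𝓡 3) (𝕊 3)}
    (hold : ∀ (x : 𝕊 1) (t : ℝ), t ∈ Icc (1 : ℝ) 2 → ‖f (x, t)‖⁻¹ • f (x, t) ≠ ((southPole : 𝕊 3) : 𝔼 4))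
    (hG : ∀ t x, G.toFun t (K x) ≠ southPole)
    (h1 : ∀ (x : 𝕊 1) (t : ℝ), t < 2 - ε → f' (x, t) = f (x, t))
    (h2 : ∀ (x : 𝕊 1) (t : ℝ), 2 - ε ≤ t → ∃ s : ℝ, f' (x, t) = t • ((G.toFun s (K x) : 𝕊 3) : 𝔼 4)) :
    ∀ (x : 𝕊 1) (t : ℝ), t ∈ Icc (1 : ℝ) 2 → ‖f' (x, t)‖⁻¹ • f' (x, t) ≠ ((southPole : 𝕊 3) : 𝔼 4) := by
  intro x t ht
  rcases lt_or_ge t (2 - ε) with h | h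
  · rw [h1 x t h]; exact hold x t ht
  · obtain ⟨s, hs⟩ := h2 x t h
    have ht0 : 0 < t := by linarith [ht.1]
    rw [hs, norm_smul, norm_eq_of_mem_sphere, mul_one, Real.norm_eq_abs, abs_of_pos ht0, smul_smul,
      inv_mul_cancel₀ ht0.ne', one_smul]
    exact fun heq ↦ hG s x (Subtype.ext heq)

/-! ### The three adjustments of an end knot -/

/-- **Normalising an end knot with a flat arc**: for a knot `K₀` off the south pole there are an
ambient isotopy chain's worth of data — here packaged as the existence, for every conical
concordance *from* `K₀`, of a conical concordance from a knot `K₁` isotopic to `K₀` whose chart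
image traverses a **unit-speed** segment `p + (θ - θa) • e` near `θa` (`e` horizontal unit), to the
same `K'`, with all directions over `[1, 2]` still off the pole. [folklore] -/
theorem exists_unitSpeed_bottom {K₀ K' : Knot} {f : (𝕊 1) × ℝ → 𝔼 4} {δ : ℝ}
    (h : IsConicalConcordance K₀ K' f δ) (hK₀ : ∀ x, K₀ x ≠ southPole)
    (hdir : ∀ (x : 𝕊 1) (t : ℝ), t ∈ Icc (1 : ℝ) 2 → ‖f (x, t)‖⁻¹ • f (x, t) ≠ ((southPole : 𝕊 3) : 𝔼 4)) :
    ∃ (K₁ : Knot) (f₁ : (𝕊 1) × ℝ → 𝔼 4) (δ₁ : ℝ), K₀.IsIsotopic K₁ ∧ (∀ x, K₁ x ≠ southPole) ∧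
      IsConicalConcordance K₁ K' f₁ δ₁ ∧
      (∀ (x : 𝕊 1) (t : ℝ), t ∈ Icc (1 : ℝ) 2 → ‖f₁ (x, t)‖⁻¹ • f₁ (x, t) ≠ ((southPole : 𝕊 3) : 𝔼 4)) ∧
      ∃ (p e : 𝔼 3) (θa ζ : ℝ), ‖e‖ = 1 ∧ e 2 = 0 ∧ 0 < ζ ∧
        ∀ θ ∈ Icc (θa - ζ) (θa + ζ), psi (K₁ (circlePoint θ)) = p + (θ - θa) • e := by
  -- (1) flatten
  obtain ⟨G₁, hG₁p, p, e, he, he2, α, θa, β, σ, hα, hβ, hσc, hσd, hσ0, hseg⟩ := K₀.exists_flatArc_isotopy hK₀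
  obtain ⟨ε₁, g₁, hε₁, -, hc₁, hg₁f, hg₁t⟩ := h.exists_splice_bottom G₁
  set Ka : Knot := K₀.map (G₁.toDiffeomorph 1) with hKa
  have hKa_apply : ∀ x, ((Ka x : 𝕊 3)) = G₁.toFun 1 (K₀ x) := fun x ↦ rfl
  have hKa_pole : ∀ x, Ka x ≠ southPole := fun x ↦ by rw [hKa_apply]; exact hG₁p 1 x
  have hKa_seg : ∀ θ ∈ Icc α β, psi (Ka (circlePoint θ)) = p + σ θ • e := fun θ hθ ↦ by
    rw [hKa_apply]; exact hseg θ hθ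
  have hdir₁ := dirOff_of_splice_bottom hdir hG₁p hg₁f hg₁t
  -- (2) homothety normalising the speed at `θa`
  have hμpos : 0 < deriv σ θa := hσd θa ⟨hα.le, hβ.le⟩
  set μ : ℝ := (deriv σ θa)⁻¹ with hμ
  have hμ0 : 0 < μ := inv_pos.2 hμpos
  set L : 𝔼 3 ≃L[ℝ] 𝔼 3 := smulEquiv hμ0.ne' (ContinuousLinearEquiv.refl ℝ (𝔼 3)) with hL
  have hLdet : 0 < (toMat (L : 𝔼 3 →L[ℝ] 𝔼 3)).det := by
    rw [hL, toMat_smulEquiv, Matrix.det_smul, ContinuousLinearEquiv.coe_refl, toMat_id, Matrix.det_one,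
      Fintype.card_fin, mul_one]
    positivity
  obtain ⟨G₂, hG₂p, hG₂⟩ := Ka.exists_ambientIsotopy_chartAffine hKa_pole p p L hLdet
  obtain ⟨ε₂, g₂, hε₂, -, hc₂, hg₂f, hg₂t⟩ := hc₁.exists_splice_bottom G₂
  set Kb : Knot := Ka.map (G₂.toDiffeomorph 1) with hKb
  have hKb_apply : ∀ x, ((Kb x : 𝕊 3)) = G₂.toFun 1 (Ka x) := fun x ↦ rfl
  have hKb_pole : ∀ x, Kb x ≠ southPole := fun x ↦ by rw [hKb_apply]; exact hG₂p 1 x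
  set σ' : ℝ → ℝ := fun θ ↦ μ * σ θ with hσ'
  have hKb_seg : ∀ θ ∈ Icc α β, psi (Kb (circlePoint θ)) = p + σ' θ • e := fun θ hθ ↦ by
    rw [hKb_apply, hG₂, hKa_seg θ hθ, add_sub_cancel_left, hL, smulEquiv_apply,
      ContinuousLinearEquiv.coe_refl', id_eq, smul_smul]
  have hσ'c : ContDiff ℝ ∞ σ' := contDiff_const.mul hσc
  have hσ'd : ∀ θ ∈ Icc α β, 0 < deriv σ' θ := fun θ hθ ↦ by
    rw [hσ', deriv_const_mul_field']; exact mul_pos hμ0 (hσd θ hθ)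
  have hσ'0 : σ' θa = 0 := by simp [hσ', hσ0]
  have hσ'1 : deriv σ' θa = 1 := by
    show deriv (fun θ ↦ μ * σ θ) θa = 1
    rw [deriv_const_mul_field, hμ, inv_mul_cancel₀ hμpos.ne']
  have hdir₂ := dirOff_of_splice_bottom hdir₁ hG₂p hg₂f hg₂t
  -- (3) unit speed
  obtain ⟨G₃, hG₃p, ζ, hζ, hG₃⟩ := Kb.exists_ambientIsotopy_unitSpeed hKb_pole he hσ'c hα hβ hσ'd hσ'0 hσ'1 hKb_seg
  obtain ⟨ε₃, g₃, hε₃, -, hc₃, hg₃f, hg₃t⟩ := hc₂.exists_splice_bottom G₃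
  set Kc : Knot := Kb.map (G₃.toDiffeomorph 1) with hKc
  have hKc_apply : ∀ x, ((Kc x : 𝕊 3)) = G₃.toFun 1 (Kb x) := fun x ↦ rfl
  have hKc_pole : ∀ x, Kc x ≠ southPole := fun x ↦ by rw [hKc_apply]; exact hG₃p 1 x
  have hdir₃ := dirOff_of_splice_bottom hdir₂ hG₃p hg₃f hg₃t
  refine ⟨Kc, g₃, ε₃ / 2, ?_, hKc_pole, hc₃, hdir₃, p, e, θa, ζ, he, he2, hζ, fun θ hθ ↦ ?_⟩
  · exact SphereEmbedding.IsIsotopic.trans_holds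
      (SphereEmbedding.IsIsotopic.trans_holds (K₀.isIsotopic_map G₁) (Ka.isIsotopic_map G₂))
      (Kb.isIsotopic_map G₃)
  · rw [hKc_apply]; exact hG₃ θ hθ

/-- The same at the outer end: **normalising the outer end knot** of a conical concordance.
[folklore] -/
theorem exists_unitSpeed_top {K K₀' : Knot} {f : (𝕊 1) × ℝ → 𝔼 4} {δ : ℝ}
    (h : IsConicalConcordance K K₀' f δ) (hK₀' : ∀ x, K₀' x ≠ southPole)
    (hdir : ∀ (x : 𝕊 1) (t : ℝ), t ∈ Icc (1 : ℝ) 2 → ‖f (x, t)‖⁻¹ • f (x, t) ≠ ((southPole : 𝕊 3) : 𝔼 4)) :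
    ∃ (K₂ : Knot) (f₁ : (𝕊 1) × ℝ → 𝔼 4) (δ₁ : ℝ), K₀'.IsIsotopic K₂ ∧ (∀ x, K₂ x ≠ southPole) ∧
      IsConicalConcordance K K₂ f₁ δ₁ ∧
      (∀ (x : 𝕊 1) (t : ℝ), t ∈ Icc (1 : ℝ) 2 → ‖f₁ (x, t)‖⁻¹ • f₁ (x, t) ≠ ((southPole : 𝕊 3) : 𝔼 4)) ∧
      ∃ (p e : 𝔼 3) (θb ζ : ℝ), ‖e‖ = 1 ∧ e 2 = 0 ∧ 0 < ζ ∧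
        ∀ θ ∈ Icc (θb - ζ) (θb + ζ), psi (K₂ (circlePoint θ)) = p + (θ - θb) • e := by
  -- (1) flatten
  obtain ⟨G₁, hG₁p, p, e, he, he2, α, θb, β, σ, hα, hβ, hσc, hσd, hσ0, hseg⟩ := K₀'.exists_flatArc_isotopy hK₀'
  obtain ⟨ε₁, g₁, hε₁, -, hc₁, hg₁f, hg₁t⟩ := h.exists_splice_top G₁
  set Ka : Knot := K₀'.map (G₁.toDiffeomorph 1) with hKa
  have hKa_apply : ∀ x, ((Ka x : 𝕊 3)) = G₁.toFun 1 (K₀' x) := fun x ↦ rfl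
  have hKa_pole : ∀ x, Ka x ≠ southPole := fun x ↦ by rw [hKa_apply]; exact hG₁p 1 x
  have hKa_seg : ∀ θ ∈ Icc α β, psi (Ka (circlePoint θ)) = p + σ θ • e := fun θ hθ ↦ by
    rw [hKa_apply]; exact hseg θ hθ
  have hdir₁ := dirOff_of_splice_top hdir hG₁p hg₁f hg₁t
  -- (2) homothety
  have hμpos : 0 < deriv σ θb := hσd θb ⟨hα.le, hβ.le⟩
  set μ : ℝ := (deriv σ θb)⁻¹ with hμ
  have hμ0 : 0 < μ := inv_pos.2 hμpos
  set L : 𝔼 3 ≃L[ℝ] 𝔼 3 := smulEquiv hμ0.ne' (ContinuousLinearEquiv.refl ℝ (𝔼 3)) with hL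
  have hLdet : 0 < (toMat (L : 𝔼 3 →L[ℝ] 𝔼 3)).det := by
    rw [hL, toMat_smulEquiv, Matrix.det_smul, ContinuousLinearEquiv.coe_refl, toMat_id, Matrix.det_one,
      Fintype.card_fin, mul_one]
    positivity
  obtain ⟨G₂, hG₂p, hG₂⟩ := Ka.exists_ambientIsotopy_chartAffine hKa_pole p p L hLdet
  obtain ⟨ε₂, g₂, hε₂, -, hc₂, hg₂f, hg₂t⟩ := hc₁.exists_splice_top G₂
  set Kb : Knot := Ka.map (G₂.toDiffeomorph 1) with hKb
  have hKb_apply : ∀ x, ((Kb x : 𝕊 3)) = G₂.toFun 1 (Ka x) := fun x ↦ rfl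
  have hKb_pole : ∀ x, Kb x ≠ southPole := fun x ↦ by rw [hKb_apply]; exact hG₂p 1 x
  set σ' : ℝ → ℝ := fun θ ↦ μ * σ θ with hσ'
  have hKb_seg : ∀ θ ∈ Icc α β, psi (Kb (circlePoint θ)) = p + σ' θ • e := fun θ hθ ↦ by
    rw [hKb_apply, hG₂, hKa_seg θ hθ, add_sub_cancel_left, hL, smulEquiv_apply,
      ContinuousLinearEquiv.coe_refl', id_eq, smul_smul]
  have hσ'c : ContDiff ℝ ∞ σ' := contDiff_const.mul hσc
  have hσ'd : ∀ θ ∈ Icc α β, 0 < deriv σ' θ := fun θ hθ ↦ by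
    rw [hσ', deriv_const_mul_field']; exact mul_pos hμ0 (hσd θ hθ)
  have hσ'0 : σ' θb = 0 := by simp [hσ', hσ0]
  have hσ'1 : deriv σ' θb = 1 := by
    show deriv (fun θ ↦ μ * σ θ) θb = 1
    rw [deriv_const_mul_field, hμ, inv_mul_cancel₀ hμpos.ne']
  have hdir₂ := dirOff_of_splice_top hdir₁ hG₂p hg₂f hg₂t
  -- (3) unit speed
  obtain ⟨G₃, hG₃p, ζ, hζ, hG₃⟩ := Kb.exists_ambientIsotopy_unitSpeed hKb_pole he hσ'c hα hβ hσ'd hσ'0 hσ'1 hKb_seg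
  obtain ⟨ε₃, g₃, hε₃, -, hc₃, hg₃f, hg₃t⟩ := hc₂.exists_splice_top G₃
  set Kc : Knot := Kb.map (G₃.toDiffeomorph 1) with hKc
  have hKc_apply : ∀ x, ((Kc x : 𝕊 3)) = G₃.toFun 1 (Kb x) := fun x ↦ rfl
  have hKc_pole : ∀ x, Kc x ≠ southPole := fun x ↦ by rw [hKc_apply]; exact hG₃p 1 x
  have hdir₃ := dirOff_of_splice_top hdir₂ hG₃p hg₃f hg₃t
  refine ⟨Kc, g₃, ε₃ / 2, ?_, hKc_pole, hc₃, hdir₃, p, e, θb, ζ, he, he2, hζ, fun θ hθ ↦ ?_⟩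
  · exact SphereEmbedding.IsIsotopic.trans_holds
      (SphereEmbedding.IsIsotopic.trans_holds (K₀'.isIsotopic_map G₁) (Ka.isIsotopic_map G₂))
      (Kb.isIsotopic_map G₃)
  · rw [hKc_apply]; exact hG₃ θ hθ

/-! ### Aligning the outer segment with the inner one -/

/-- **Aligning the outer end**: given the inner data `p₁, e₁, θa` and an outer end knot whose
chart image traverses `p₂ + (θ - θb) • e₂` near `θb` (`e₁, e₂` horizontal unit vectors), the
rigid motion `x ↦ p₁ + R (x - p₂)` (`R = horizRot e₁ e₂`) followed by the rotation of the
parameter by `θb - θa` produces an isotopic outer end knot traversing `p₁ + (θ - θa) • e₁` near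
`θa`; spliced into the upper cone. [folklore] -/
theorem exists_align_top {K K₂ : Knot} {f : (𝕊 1) × ℝ → 𝔼 4} {δ : ℝ}
    (h : IsConicalConcordance K K₂ f δ) (hK₂ : ∀ x, K₂ x ≠ southPole)
    (hdir : ∀ (x : 𝕊 1) (t : ℝ), t ∈ Icc (1 : ℝ) 2 → ‖f (x, t)‖⁻¹ • f (x, t) ≠ ((southPole : 𝕊 3) : 𝔼 4))
    {p₁ e₁ p₂ e₂ : 𝔼 3} (he₁ : ‖e₁‖ = 1) (he₁2 : e₁ 2 = 0) (he₂ : ‖e₂‖ = 1) (he₂2 : e₂ 2 = 0)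
    {θa θb ζ : ℝ}
    (hseg : ∀ θ ∈ Icc (θb - ζ) (θb + ζ), psi (K₂ (circlePoint θ)) = p₂ + (θ - θb) • e₂) :
    ∃ (K₃ : Knot) (f₁ : (𝕊 1) × ℝ → 𝔼 4) (δ₁ : ℝ), K₂.IsIsotopic K₃ ∧ (∀ x, K₃ x ≠ southPole) ∧
      IsConicalConcordance K K₃ f₁ δ₁ ∧
      (∀ (x : 𝕊 1) (t : ℝ), t ∈ Icc (1 : ℝ) 2 → ‖f₁ (x, t)‖⁻¹ • f₁ (x, t) ≠ ((southPole : 𝕊 3) : 𝔼 4)) ∧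
      ∀ θ ∈ Icc (θa - ζ) (θa + ζ), psi (K₃ (circlePoint θ)) = p₁ + (θ - θa) • e₁ := by
  -- (1) the rigid motion
  have hpq := rotP_sq_add_rotQ_sq he₁ he₁2 he₂ he₂2
  set R : 𝔼 3 ≃L[ℝ] 𝔼 3 := horizRot hpq with hR
  have hRdet : 0 < (toMat (R : 𝔼 3 →L[ℝ] 𝔼 3)).det := by rw [hR, det_toMat_horizRot]; exact one_pos
  have hRe : R e₂ = e₁ := horizRot_apply_e₂ he₁ he₁2 he₂ he₂2
  obtain ⟨G₁, hG₁p, hG₁⟩ := K₂.exists_ambientIsotopy_chartAffine hK₂ p₂ p₁ R hRdet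
  obtain ⟨ε₁, g₁, hε₁, -, hc₁, hg₁f, hg₁t⟩ := h.exists_splice_top G₁
  set Ka : Knot := K₂.map (G₁.toDiffeomorph 1) with hKa
  have hKa_apply : ∀ x, ((Ka x : 𝕊 3)) = G₁.toFun 1 (K₂ x) := fun x ↦ rfl
  have hKa_pole : ∀ x, Ka x ≠ southPole := fun x ↦ by rw [hKa_apply]; exact hG₁p 1 x
  have hKa_seg : ∀ θ ∈ Icc (θb - ζ) (θb + ζ), psi (Ka (circlePoint θ)) = p₁ + (θ - θb) • e₁ := by
    intro θ hθ
    rw [hKa_apply, hG₁, hseg θ hθ, add_sub_cancel_left, map_smul, hRe]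
  have hdir₁ := dirOff_of_splice_top hdir hG₁p hg₁f hg₁t
  -- (2) the rotation of the parameter
  obtain ⟨G₂, hG₂r, hG₂⟩ := Ka.exists_ambientIsotopy_rotateParam (θb - θa)
  have hG₂p : ∀ t x, G₂.toFun t (Ka x) ≠ southPole := by
    intro t x
    obtain ⟨y, hy⟩ := hG₂r t x
    rw [← hy]; exact hKa_pole y
  obtain ⟨ε₂, g₂, hε₂, -, hc₂, hg₂f, hg₂t⟩ := hc₁.exists_splice_top G₂
  set Kb : Knot := Ka.map (G₂.toDiffeomorph 1) with hKb
  have hKb_apply : ∀ x, ((Kb x : 𝕊 3)) = G₂.toFun 1 (Ka x) := fun x ↦ rfl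
  have hKb_pole : ∀ x, Kb x ≠ southPole := fun x ↦ by rw [hKb_apply]; exact hG₂p 1 x
  have hdir₂ := dirOff_of_splice_top hdir₁ hG₂p hg₂f hg₂t
  refine ⟨Kb, g₂, ε₂ / 2, ?_, hKb_pole, hc₂, hdir₂, fun θ hθ ↦ ?_⟩
  · exact SphereEmbedding.IsIsotopic.trans_holds (K₂.isIsotopic_map G₁) (Ka.isIsotopic_map G₂)
  · rw [hKb_apply, hG₂ θ, hKa_seg (θ + (θb - θa)) ⟨by linarith [hθ.1], by linarith [hθ.2]⟩]
    congr 1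
    ring_nf

/-! ### The main result -/

/-- **From a concordance to a long annulus with a common flat arc at both ends.** If `K` and `K'`
are concordant there are isotopic knots `K₁ ~ K`, `K₂ ~ K'` off the south pole and a long annulus
of `ℝ³ × ℝ` whose end curves are their chart images, with flat collars at a common parameter:
both end curves are the segment `x₀ + 2π(θ - θ₁) • e` near `θ₁ = θa / 2π`, `e` horizontal.
[folklore] -/
theorem IsConcordant.exists_flat_longAnnulus {K K' : Knot} (h : K.IsConcordant K') :
    ∃ (K₁ K₂ : Knot) (η : ℝ) (A : LongAnnulus η) (θ₁ ζ : ℝ) (x₀ e : 𝔼 3),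
      K.IsIsotopic K₁ ∧ K'.IsIsotopic K₂ ∧ (∀ x, K₁ x ≠ southPole) ∧ (∀ x, K₂ x ≠ southPole) ∧
      (A.k₁ = fun θ ↦ psi (K₁ (circlePt θ))) ∧ (A.k₂ = fun θ ↦ psi (K₂ (circlePt θ))) ∧ e 2 = 0 ∧
      A.FlatAt θ₁ ζ x₀ e (fun θ ↦ 2 * π * (θ - θ₁)) := by
  -- conical, off the pole
  obtain ⟨f, δ, hc⟩ := h.exists_isConicalConcordance
  obtain ⟨φ, J, -, -, hKφ, hK'φ, hc₀, hK₀, hK₀', hmid₀⟩ := hc.exists_offPole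
  have hdir₀ : ∀ (x : 𝕊 1) (t : ℝ), t ∈ Icc (1 : ℝ) 2 →
      ‖((J : 𝔼 4 → 𝔼 4) ∘ f) (x, t)‖⁻¹ • ((J : 𝔼 4 → 𝔼 4) ∘ f) (x, t) ≠ ((southPole : 𝕊 3) : 𝔼 4) := by
    intro x t ht
    rw [← circlePt_angA x]
    exact hmid₀ (angA x) t ht
  -- the inner end
  obtain ⟨K₁, f₁, δ₁, hiso₁, hK₁, hc₁, hdir₁, p₁, e₁, θa, ζ₁, he₁, he₁2, hζ₁, hseg₁⟩ :=
    exists_unitSpeed_bottom hc₀ hK₀ hdir₀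
  -- the outer end
  obtain ⟨K₂', f₂, δ₂, hiso₂, hK₂', hc₂, hdir₂, p₂, e₂, θb, ζ₂, he₂, he₂2, hζ₂, hseg₂⟩ :=
    exists_unitSpeed_top hc₁ hK₀' hdir₁
  -- align
  set ζ : ℝ := min ζ₁ ζ₂ with hζ
  have hζpos : 0 < ζ := lt_min hζ₁ hζ₂
  obtain ⟨K₂, f₃, δ₃, hiso₃, hK₂, hc₃, hdir₃, hseg₃⟩ := exists_align_top hc₂ hK₂' hdir₂ he₁ he₁2 he₂ he₂2
    (p₁ := p₁) (θa := θa) (ζ := ζ)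
    (fun θ hθ ↦ hseg₂ θ ⟨by linarith [hθ.1, min_le_right ζ₁ ζ₂], by linarith [hθ.2, min_le_right ζ₁ ζ₂]⟩)
  -- chart
  have hpole : ∀ q, hc₃.dirS q ≠ southPole := hc₃.dirS_ne_southPole hK₁ hK₂ fun θ t ht ↦ by
    have := hdir₃ (circlePt θ) t ht
    rwa [annulusLift_apply]
  obtain ⟨η, A, -, hk₁, hk₂, -, -⟩ := hc₃.exists_longAnnulus hpole
  refine ⟨K₁, K₂, η, A, θa / (2 * π), ζ / (2 * π), p₁, e₁,
    SphereEmbedding.IsIsotopic.trans_holds hKφ hiso₁,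
    SphereEmbedding.IsIsotopic.trans_holds (SphereEmbedding.IsIsotopic.trans_holds hK'φ hiso₂) hiso₃,
    hK₁, hK₂, hk₁, hk₂, he₁2, ?_⟩
  have hπ := Real.pi_pos
  have hwin : ∀ θ ∈ Icc (θa / (2 * π) - ζ / (2 * π)) (θa / (2 * π) + ζ / (2 * π)),
      2 * π * θ ∈ Icc (θa - ζ) (θa + ζ) := by
    intro θ hθ
    constructor
    · have := hθ.1; rw [← sub_div, div_le_iff₀ (by positivity)] at this; linarith
    · have := hθ.2; rw [← add_div, le_div_iff₀ (by positivity)] at this; linarith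
  have hσ : ∀ θ, 2 * π * (θ - θa / (2 * π)) = 2 * π * θ - θa := fun θ ↦ by field_simp
  exact
    { ζ_pos := by positivity
      norm_e := he₁
      contDiff_σ := contDiff_const.mul (contDiff_id.sub contDiff_const)
      σ_θ₁ := by simp
      deriv_σ_pos := fun θ _ ↦ by
        rw [show (fun θ ↦ 2 * π * (θ - θa / (2 * π))) = fun θ ↦ 2 * π * (id θ - θa / (2 * π)) from rfl,
          deriv_const_mul _ (differentiableAt_id.sub_const _), deriv_sub_const, deriv_id, mul_one]
        positivity
      k₁_eq := fun θ hθ ↦ by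
        have h1 := hseg₁ (2 * π * θ) (let hw := hwin θ hθ; ⟨by linarith [hw.1, min_le_left ζ₁ ζ₂],
          by linarith [hw.2, min_le_left ζ₁ ζ₂]⟩)
        rw [hk₁, hσ]
        simp only [circlePt_eq_circlePoint]
        rw [h1]
      k₂_eq := fun θ hθ ↦ by
        have h1 := hseg₃ (2 * π * θ) (hwin θ hθ)
        rw [hk₂, hσ]
        simp only [circlePt_eq_circlePoint]
        rw [h1] }

end Knot

end Literature.Topology.FourManifolds
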